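import Literature.Barriers.AtomisticToContinuum.OneDimensionalHardCoreToeplitz
import HarnessLib

/-!
# Dyson's `√N` law for the Girardeau gas (`OneDimensionalHardCoreSqrt`): fact decomposition —
# Widom's two-zero Fisher–Hartwig asymptotics as the one named input

`Literature/Barriers/AtomisticToContinuum` (D-0021 barrier catalogue, conjunct
`BoseEinsteinCondensation`). FACT-SPLIT file (librarian, mode `fact-decompose`, 2026-08-16) for the
budget-capped XL named fact `Literature.Barriers.AtomisticToContinuum.OneDimensionalHardCoreSqrt`
(`OneDimensionalHardCore.lean`: `c₀(N)/√N → C > 0` for the zero-momentum occupation of Girardeau's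
ground state of `N` impenetrable bosons on a ring; order: Szegő–Lenard 1963/64, constant: Dyson's
conjecture, proved by Claeys–Krasovsky 2015).

State of the tree (sixth audit, 2026-08-16): Lenard's Toeplitz formula, Szegő's inequality and the
two-sided ORDER `e^{-3/4}√(N+1) ≤ c₀(N) ≤ 4e√N` are theorems
(`OneDimensionalHardCoreToeplitz.lean`, `OneDimensionalHardCoreLowerBound.lean`); the pure
(`tendsto_pureDet_div_rpow`) and antipodal (`fisherHartwig_antipodal`) Fisher–Hartwig limits are
theorems (`OneDimensionalHardCorePureAsymptotics.lean`); and
`oneDimensionalHardCoreSqrt_of_fisherHartwig` (`OneDimensionalHardCoreToeplitz.lean`) PROVES the fact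
— by Lenard's formula, the Szegő–Lenard integrable majorant and dominated convergence — from ONE
hypothesis `hFH`: the POINTWISE Fisher–Hartwig asymptotics of the Toeplitz determinant of Lenard's
symbol with two zero-type singularities, Widom's theorem (1973) at `α₁ = α₂ = ½` (Lenard's 1972
conjecture (53)), with the constant existential. This file names that hypothesis (D-0014 named fact)
and records the PROVED assembly:

* `Widom1973_fisherHartwig_twoZerosHalf` — there is `E > 0` (printed: `E = G(3/2)⁴`) such that for all
  `θ₁, θ₂` with `e^{iθ₁} ≠ e^{iθ₂}`,
  `D_n(|z − e^{iθ₁}| |z − e^{iθ₂}|)/√n → E |e^{iθ₁} − e^{iθ₂}|^{-1/2}` (`toeplitzDet ∘ circleCoeff` of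
  the tree's `Literature.Analysis.Toeplitz`);
* `OneDimensionalHardCoreSqrt_holds_of : Widom1973_fisherHartwig_twoZerosHalf → OneDimensionalHardCoreSqrt`
  — PROVED (it is `oneDimensionalHardCoreSqrt_of_fisherHartwig`).

The child is a theorem about Toeplitz determinants (no Bose gas), more general than and upstream of the
parent; the reduction to it is the non-trivial part already in the tree; it is not a rewording of the
parent. A finer split (Widom's separation/localisation theorem for several singularities + the pure
one-singularity constant, the latter already proved) would only re-package the same statement.

## References

* [Widom1973] H. Widom, *Toeplitz determinants with singular generating functions*, Amer. J. Math.
  95 (1973) 333–383 (the theorem for `∏_j |z − z_j|^{2α_j}`, `Re α_j > −½`).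
* [DeiftItsKrasovsky2013] P. Deift, A. Its, I. Krasovsky, Comm. Pure Appl. Math. 66 (2013)
  1360–1438, arXiv:1207.4990: §6 (eq81), (eq83)–(eq85) (Widom's theorem and the constant
  `E(f) = ∏ G(1+α_j)²/G(1+2α_j) ∏_{j<k} |z_j − z_k|^{−2α_jα_k}`), Remark 8.
* [Lenard1972] A. Lenard, Pacific J. Math. 42 (1972) 137–145, (53) (the conjecture for general `θ`).
* [ClaeysKrasovsky2015] T. Claeys, I. Krasovsky, Duke Math. J. 164 (2015), §1 (Lrho0)–(LDy),
  Thm 1.6, Remark 10.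
-/

noncomputable section

open Filter Topology Complex
open Literature.Analysis.Toeplitz

namespace Literature.Barriers.AtomisticToContinuum

/-- NAMED FACT — **Widom 1973: Fisher–Hartwig asymptotics for two zero-type singularities of
exponent `½`** (the law predicted by Lenard 1972, eq. (53); a THEOREM of Widom 1973). There is a constant `E > 0` — printed value
`E = G(3/2)⁴ ≈ 1.3069`, `G` the Barnes function (not in Mathlib, hence existential) — such that for
all real `θ₁, θ₂` with `e^{iθ₁} ≠ e^{iθ₂}`, the `n × n` Toeplitz determinants of the symbol
`f(e^{iθ}) = |e^{iθ} − e^{iθ₁}| · |e^{iθ} − e^{iθ₂}|` satisfy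
`D_n(f)/√n → E · |e^{iθ₁} − e^{iθ₂}|^{−1/2}` as `n → ∞` (Widom's formula
`D_n(∏|z − z_j|^{2α_j}) ∼ E n^{Σα_j²}`, `E = ∏_j G(1+α_j)²/G(1+2α_j) · ∏_{j<k}|z_j − z_k|^{−2α_jα_k}`,
at `α₁ = α₂ = ½`: `n^{1/2}`, `G(2) = 1`). Stated with the tree's `toeplitzDet` and `circleCoeff`
(`Literature/Analysis/Toeplitz/StrongSzego.lean`); it is the hypothesis `hFH` of
`oneDimensionalHardCoreSqrt_of_fisherHartwig`, verbatim. The antipodal case `e^{iθ₂} = −e^{iθ₁}` and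
the one-singularity analogue are proved in `OneDimensionalHardCorePureAsymptotics.lean`. Users take
`(h : Widom1973_fisherHartwig_twoZerosHalf)`.
[cite: Widom1973, Theorem (symbols ∏|z − z_j|^{2α_j})] [cite: DeiftItsKrasovsky2013, §6 (eq81), (eq83)–(eq85)] -/
def Widom1973_fisherHartwig_twoZerosHalf : Prop :=
  ∃ E : ℝ, 0 < E ∧ ∀ θ₁ θ₂ : ℝ, cexp (θ₁ * I) ≠ cexp (θ₂ * I) →
    Tendsto (fun n : ℕ =>
        toeplitzDet (circleCoeff fun θ : ℝ =>
            ((‖(cexp (θ * I) - cexp (θ₁ * I)) * (cexp (θ * I) - cexp (θ₂ * I))‖ : ℝ) : ℂ)) n /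
          ((Real.sqrt n : ℝ) : ℂ))
      atTop (𝓝 (((E * ‖cexp (θ₁ * I) - cexp (θ₂ * I)‖ ^ (-(1 / 2 : ℝ)) : ℝ) : ℂ)))

/-- **Assembly (PROVED): Dyson's `√N` law from Widom's two-zero Fisher–Hartwig asymptotics** —
Lenard's formula `c₀(n+1) = (2π)⁻¹ ∫₀^{2π} R(n,t) dt`, the Szegő–Lenard majorant
`R(n,t)/√n ≤ 2e√π (t^{-1/2} + (2π−t)^{-1/2})` and dominated convergence; this is
`oneDimensionalHardCoreSqrt_of_fisherHartwig` (`OneDimensionalHardCoreToeplitz.lean`). Discharging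
the child discharges `OneDimensionalHardCoreSqrt`.
[cite: ClaeysKrasovsky2015, §1 (Lrho0)–(LDy)] [cite: DeiftItsKrasovsky2013, Remark 8] -/
theorem OneDimensionalHardCoreSqrt_holds_of (h : Widom1973_fisherHartwig_twoZerosHalf) :
    OneDimensionalHardCoreSqrt :=
  oneDimensionalHardCoreSqrt_of_fisherHartwig h

end Literature.Barriers.AtomisticToContinuum

end
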